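import Mathlib.NumberTheory.ZetaValues
import Mathlib.Analysis.Real.Pi.Bounds
import Literature.Analysis.Calculus.ExpDifferentialGSeries

/-!
# `g⁻¹(T) = T/(1 − e^{−T}) = Σ B⁺ₙ Tⁿ/n!` on `‖T‖ < 2π`: the Bernoulli expansion of the inverse of `g`

Topic `Analysis/Calculus`; namespace `Literature.Analysis.Calculus.ExpDifferential` (fourth file of the group around
the function `g(z) = (1 − e^{−z})/z` of the differential of the exponential map; companion of
`ExpDifferentialGSeries` (the `g`-series, `g⁻¹ := Ring.inverse (g T)` on `‖T‖ ≤ 1`) and `ExpDifferentialBijective`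
(the exact domain `z ≠ 2kπi`)).

statement-level skeleton of published theorems with citation tags; proofs where landed; nothing here is a claim about the Yang–Mills mass gap

Generic Mathlib-style support file written for the cell `lit-balaban` (HOME `run/shared/lean/pub/lit-balaban/`, unit
`lit-balaban-p28`, Phase-2 proof seat p28 gen 7): SKELETON row B7.Eq32 ((32)–(35)) of [Balaban1985Averaging],
members (34)–(35), which `ExpDifferentialGSeries` recorded as «NOT reproduced here: the Bernoulli-number expansion
g⁻¹(z) = 1 + ½z + …, f(z) = g⁻¹(z) − ½z is even (34)–(35) … (only the disc ‖T‖ ≤ 1 is treated)».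

THE PRINTED STATEMENTS.  T. Bałaban, *Averaging operations for lattice gauge theories*, CMP **98** (1985) 17–51
[Balaban1985Averaging], p. 23: *"hence the function g⁻¹(z) = 1/g(z) is an analytic function in a neighborhood of 0,
more exactly for z ≠ 2kπi, k = ±1, ±2, …, and we have the identities
  g⁻¹(z) = −z/(e^{−z} − 1),  g⁻¹(−z) = g⁻¹(z) − z,  g⁻¹(z) = 1 + ½z + … .   (34)
Defining f(z) = g⁻¹(z) − ½z, we have f(−z) = f(z), so
  f(z) = 1 + Σ_{p=1}^∞ k_{2p} z^{2p},  g⁻¹(z) = f(z) + ½z,  g⁻¹(−z) = f(z) − ½z.   (35)"*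
(with *"the function f(ad_X) can be defined by the power series expansion"*, p. 22).  Since
`g⁻¹(z) = z/(1 − e^{−z}) = z e^{z}/(e^{z} − 1)`, the coefficients are the Bernoulli numbers: `g⁻¹(z) = Σ_{n≥0} B⁺ₙ zⁿ/n!`
with Mathlib's `bernoulli'` (`B⁺₁ = +½`; `bernoulli'PowerSeries_mul_exp_sub_one : (Σ B⁺ₙ Xⁿ/n!)(e^X − 1) = X e^X`),
so `k_{2p} = B_{2p}/(2p)!`, and the series converges exactly for `|z| < 2π` (the distance to the nearest zeros `±2πi`
of `g`).

WHAT THIS FILE PROVES (everything `sorry`-free; `T` an element of a Banach algebra `E` over `𝕂 = ℝ` or `ℂ` with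
`‖1‖ = 1`):
* §1 `abs_bernoulli_div_factorial_le : |B_{2k}|/(2k)! ≤ (π²/3)/(2π)^{2k}` (`k ≥ 1`; from Euler's formula for
  `ζ(2k)`, Mathlib `hasSum_zeta_nat`, and `ζ(2k) ≤ ζ(2) = π²/6`) and the uniform majorant
  `abs_bernoulli'_div_factorial_le : |B⁺ₙ|/n! ≤ (π²/3)/(2π)ⁿ` for every `n`;
* §2 the formal identity behind (34): `Σ_{i+j=N} (B⁺ᵢ/i!)((−1)ʲ/(j+1)!) = δ_{N,0}` (`sum_antidiagonal_bernoulli'_gCoeff`;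
  power series over `ℚ`: `B⁺(X)·(1 − e^{−X})/X = 1`);
* §3 absolute convergence of `Σ (B⁺ₙ/n!) Tⁿ` for `‖T‖ < 2π` (`summable_norm_bernoulli_term`) and the Cauchy products
  `(Σ (B⁺ₙ/n!) Tⁿ)·g(T) = 1 = g(T)·(Σ (B⁺ₙ/n!) Tⁿ)` (`tsum_bernoulli_mul_gSer`, `gSer_mul_tsum_bernoulli`);
* §4 **(34) on the sharp disc**: for `‖T‖ < 2π`, `g(T)` is invertible (`isUnit_gSer_of_norm_lt`, improving the tree's
  `isUnit_gSer`, `‖T‖ ≤ 1`, and — beyond finite dimensions — `ExpDifferentialBijective.isUnit_gSer_of_norm_lt_two_pi`)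
  with **`gInv_eq_tsum_bernoulli : g⁻¹(T) = Σ_{n≥0} (B⁺ₙ/n!) Tⁿ`** («g⁻¹(z) = 1 + ½z + …» with ALL coefficients),
  `gInv_mul_gSer_of_norm_lt` / `gSer_mul_gInv_of_norm_lt`;
* §5 **(35) with the coefficients named**: `gInv_sub_half_smul_eq_tsum_even :
  g⁻¹(T) − ½T = Σ_{p≥0} (B_{2p}/(2p)!) T^{2p}` (the `p = 0` term is `1`, so this is «f(z) = 1 + Σ_{p≥1} k_{2p}z^{2p}» with
  `k_{2p} = B_{2p}/(2p)!`; odd Bernoulli numbers vanish, `bernoulli'_eq_zero_of_odd`), evenness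
  `gInv_neg_sub_eq : g⁻¹(−T) + ½T = g⁻¹(T) − ½T` («f(−z) = f(z)») and **`gInv_neg_of_norm_lt : g⁻¹(−T) = g⁻¹(T) − T`**
  («g⁻¹(−z) = g⁻¹(z) − z», (34), now on `‖T‖ < 2π`; the tree's `gInv_neg` needs `‖T‖ ≤ 1`).

HONEST SCOPE.  The maximal domain «z ≠ 2kπi» of analyticity of the scalar `g⁻¹` (a meromorphic statement) is NOT a
disc statement; it is `ExpDifferentialBijective.gSer_eq_zero_iff` (+ `…Balaban1983to89` scalar corollaries).  Here only
the disc `‖T‖ < 2π` of convergence of the printed power series is treated, which is where (34)–(35) are used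
(Bałaban applies them at `±ad_Y`, `±i ad_Y` with `|Y|` small, pp. 23–24).

## References
* [Balaban1985Averaging] T. Bałaban, CMP **98** (1985) 17–51, (34)–(35) p. 23 (held: `paper:balaban1985-cmp98-averaging`, p. 7
  read).
* Mathlib: `bernoulli'PowerSeries_mul_exp_sub_one`, `bernoulli'_eq_zero_of_odd` (`NumberTheory.Bernoulli`),
  `hasSum_zeta_nat`, `hasSum_zeta_two` (`NumberTheory.ZetaValues`).
-/

noncomputable section

open NormedSpace Filter Finset
open scoped Topology Nat Real

namespace Literature.Analysis.Calculus.ExpDifferential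

/-! ### §1. Size of the Bernoulli numbers: `|Bₙ|/n! ≤ (π²/3)(2π)^{−n}` -/

section BernoulliBound

/-- `ζ(2k) ≤ ζ(2) = π²/6` (termwise comparison `n^{−2k} ≤ n^{−2}`), with Euler's formula
`ζ(2k) = (−1)^{k+1} 2^{2k−1} π^{2k} B_{2k}/(2k)!`: hence `|B_{2k}|/(2k)! ≤ (π²/3)/(2π)^{2k}` for `k ≥ 1`.
[cite: Balaban1985Averaging, (34)-(35) p.23] -/
theorem abs_bernoulli_div_factorial_le {k : ℕ} (hk : k ≠ 0) :
    |(bernoulli (2 * k) : ℝ)| / (2 * k)! ≤ (π ^ 2 / 3) / (2 * π) ^ (2 * k) := by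
  have hS := hasSum_zeta_nat hk
  set S : ℝ := (-1 : ℝ) ^ (k + 1) * (2 : ℝ) ^ (2 * k - 1) * π ^ (2 * k) * bernoulli (2 * k) / (2 * k)! with hSdef
  -- `0 ≤ S ≤ π²/6`
  have hle : S ≤ π ^ 2 / 6 := by
    refine hasSum_le (fun n => ?_) hS hasSum_zeta_two
    rcases Nat.eq_zero_or_pos n with rfl | hn
    · have h2k : 2 * k ≠ 0 := by omega
      simp [zero_pow h2k]
    · have hn' : (1 : ℝ) ≤ n := by exact_mod_cast hn
      have hpow : (n : ℝ) ^ 2 ≤ (n : ℝ) ^ (2 * k) := pow_le_pow_right₀ hn' (by omega)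
      exact one_div_le_one_div_of_le (by positivity) hpow
  have hnonneg : 0 ≤ S := hS.nonneg fun n => by positivity
  -- `|S| = 2^{2k-1} π^{2k} |B_{2k}|/(2k)!`
  have hpos : (0 : ℝ) < (2 : ℝ) ^ (2 * k - 1) * π ^ (2 * k) := by positivity
  have habs : |S| = (2 : ℝ) ^ (2 * k - 1) * π ^ (2 * k) * (|(bernoulli (2 * k) : ℝ)| / (2 * k)!) := by
    rw [hSdef, abs_div, abs_mul, abs_mul, abs_mul, abs_pow, abs_neg, abs_one, one_pow, one_mul,
      abs_of_pos (by positivity : (0 : ℝ) < 2 ^ (2 * k - 1)), abs_of_pos (by positivity : (0 : ℝ) < π ^ (2 * k)),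
      Nat.abs_cast]
    ring
  have hmain : (2 : ℝ) ^ (2 * k - 1) * π ^ (2 * k) * (|(bernoulli (2 * k) : ℝ)| / (2 * k)!) ≤ π ^ 2 / 6 := by
    rw [← habs, abs_of_nonneg hnonneg]; exact hle
  -- divide
  have h2 : (2 : ℝ) ^ (2 * k) = 2 * 2 ^ (2 * k - 1) := by
    rw [← pow_succ']; congr 1; omega
  have hB : 0 ≤ |(bernoulli (2 * k) : ℝ)| / (2 * k)! := by positivity
  rw [le_div_iff₀ (by positivity : (0 : ℝ) < (2 * π) ^ (2 * k)), mul_pow, h2]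
  nlinarith [hmain, hpos, hB]

/-- The uniform majorant `|B⁺ₙ|/n! ≤ (π²/3)/(2π)ⁿ` (all `n`): `n = 0`: `1 ≤ π²/3`; `n = 1`: `½ ≤ π/6`; odd `n ≥ 3`:
`B⁺ₙ = 0`; even `n = 2k ≥ 2`: `abs_bernoulli_div_factorial_le`.  This gives the radius of convergence `2π` of the
series (34)–(35). [cite: Balaban1985Averaging, (34)-(35) p.23] -/
theorem abs_bernoulli'_div_factorial_le (n : ℕ) :
    |(bernoulli' n : ℝ)| / n ! ≤ (π ^ 2 / 3) / (2 * π) ^ n := by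
  have hπ := Real.pi_gt_three
  rcases Nat.even_or_odd n with ⟨k, rfl⟩ | hodd
  · rcases Nat.eq_zero_or_pos k with rfl | hk
    · norm_num [bernoulli'_zero]
      nlinarith
    · have hk' : k ≠ 0 := Nat.pos_iff_ne_zero.mp hk
      have h := abs_bernoulli_div_factorial_le hk'
      rw [← two_mul, bernoulli'_eq_bernoulli]
      push_cast
      rwa [show (-1 : ℝ) ^ (2 * k) = 1 from (even_two_mul k).neg_one_pow, one_mul]
  · rcases hodd with ⟨k, rfl⟩
    rcases Nat.eq_zero_or_pos k with rfl | hk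
    · norm_num [bernoulli'_one]
      rw [div_le_div_iff₀ (by norm_num) (by positivity)]
      nlinarith
    · have hodd' : Odd (2 * k + 1) := ⟨k, rfl⟩
      rw [bernoulli'_eq_zero_of_odd hodd' (by omega)]
      simp only [Rat.cast_zero, abs_zero, zero_div]
      positivity

end BernoulliBound

/-! ### §2. The formal identity `Σ_{i+j=N} (B⁺ᵢ/i!)((−1)ʲ/(j+1)!) = δ_{N,0}` -/

section Formal

open PowerSeries

/-- The coefficients `(−1)ʲ/(j+1)!` of `g` form the power series `G` with `X·G = 1 − e^{−X}` over `ℚ`. [folklore] -/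
private theorem X_mul_gSeries :
    (X : PowerSeries ℚ) * PowerSeries.mk (fun j : ℕ => (-1 : ℚ) ^ j / (j + 1)!) =
      1 - evalNegHom (exp ℚ) := by
  ext n
  rcases n with _ | n
  · rw [coeff_zero_X_mul, map_sub, coeff_one, evalNegHom, coeff_rescale, coeff_exp]
    simp
  · rw [coeff_succ_X_mul, coeff_mk, map_sub, coeff_one, evalNegHom, coeff_rescale, coeff_exp]
    simp [pow_succ, div_eq_mul_inv]

/-- `B⁺(X) · G(X) = 1` in `ℚ⟦X⟧` (from `B⁺(X)(e^X − 1) = X e^X` and `e^X e^{−X} = 1`). [folklore] -/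
private theorem bernoulli'PowerSeries_mul_gSeries :
    bernoulli'PowerSeries ℚ * PowerSeries.mk (fun j : ℕ => (-1 : ℚ) ^ j / (j + 1)!) = 1 := by
  set G : PowerSeries ℚ := PowerSeries.mk (fun j : ℕ => (-1 : ℚ) ^ j / (j + 1)!) with hG
  have hB := bernoulli'PowerSeries_mul_exp_sub_one ℚ
  have hE := PowerSeries.exp_mul_exp_neg_eq_one (A := ℚ)
  have hXG : (X : PowerSeries ℚ) * G = 1 - evalNegHom (exp ℚ) := X_mul_gSeries
  -- `X · (B⁺ G) = B⁺ · (1 − e^{−X}) = B⁺ (e^X − 1) e^{−X} = X e^X e^{−X} = X`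
  have h1 : (X : PowerSeries ℚ) * (bernoulli'PowerSeries ℚ * G) = X := by
    calc (X : PowerSeries ℚ) * (bernoulli'PowerSeries ℚ * G)
        = bernoulli'PowerSeries ℚ * (X * G) := by ring
      _ = bernoulli'PowerSeries ℚ * (exp ℚ - 1) * evalNegHom (exp ℚ) := by
          rw [hXG]; linear_combination (-(bernoulli'PowerSeries ℚ)) * hE
      _ = X := by rw [hB, mul_assoc, hE, mul_one]
  have h2 : (X : PowerSeries ℚ) * (bernoulli'PowerSeries ℚ * G - 1) = 0 := by
    rw [mul_sub, h1, mul_one, sub_self]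
  rcases mul_eq_zero.mp h2 with hX | h
  · exact absurd hX X_ne_zero
  · exact sub_eq_zero.mp h

/-- **The coefficient identity of (34)**: `Σ_{i+j=N} (B⁺ᵢ/i!)·((−1)ʲ/(j+1)!) = 1` if `N = 0` and `= 0` otherwise — i.e.
`(Σ B⁺ₙzⁿ/n!)·g(z) = 1` coefficientwise, `g(z) = Σ (−1)ʲzʲ/(j+1)!`. [cite: Balaban1985Averaging, (34) p.23] -/
theorem sum_antidiagonal_bernoulli'_gCoeff (N : ℕ) :
    ∑ p ∈ antidiagonal N, (bernoulli' p.1 / (p.1)! : ℚ) * ((-1 : ℚ) ^ p.2 / (p.2 + 1)!) =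
      if N = 0 then 1 else 0 := by
  have h := congrArg (coeff N) bernoulli'PowerSeries_mul_gSeries
  rw [coeff_mul, coeff_one] at h
  rw [← h]
  refine sum_congr rfl fun p _ => ?_
  simp [bernoulli'PowerSeries, coeff_mk]

end Formal

/-! ### §3. The series `Σ (B⁺ₙ/n!) Tⁿ` in a Banach algebra and its Cauchy product with `g(T)` -/

section Banach

variable {𝕂 : Type*} [RCLike 𝕂] {E : Type*} [NormedRing E] [NormedAlgebra 𝕂 E]

/-- Norm of a rational scalar in `𝕂 = ℝ, ℂ`: `‖(q : 𝕂)‖ = |q|`. [folklore] -/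
private theorem norm_ratCast_rclike (q : ℚ) : ‖((q : ℚ) : 𝕂)‖ = |(q : ℝ)| := by
  rw [← RCLike.ofReal_ratCast, RCLike.norm_ofReal]

/-- `‖Tⁿ‖ ≤ ‖T‖ⁿ` in a normed ring with `‖1‖ = 1`. [folklore] -/
private theorem norm_pow_le_pow_norm [NormOneClass E] (T : E) (n : ℕ) : ‖T ^ n‖ ≤ ‖T‖ ^ n := by
  rcases n with _ | n
  · simp
  · exact norm_pow_le' T (Nat.succ_pos n)

/-- **Absolute convergence of (34) on `‖T‖ < 2π`**: `Σ ‖(B⁺ₙ/n!) Tⁿ‖ < ∞` (majorant `(π²/3)(‖T‖/2π)ⁿ`).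
[cite: Balaban1985Averaging, (34) p.23] -/
theorem summable_norm_bernoulli_term [NormOneClass E] {T : E} (hT : ‖T‖ < 2 * π) :
    Summable fun n : ℕ => ‖((bernoulli' n / n ! : ℚ) : 𝕂) • T ^ n‖ := by
  have hπ : (0 : ℝ) < 2 * π := by positivity
  have hr : ‖T‖ / (2 * π) < 1 := (div_lt_one hπ).mpr hT
  have hr0 : 0 ≤ ‖T‖ / (2 * π) := div_nonneg (norm_nonneg _) hπ.le
  refine Summable.of_nonneg_of_le (fun _ => norm_nonneg _) (fun n => ?_)
    ((summable_geometric_of_lt_one hr0 hr).mul_left (π ^ 2 / 3))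
  have hcoef : ‖((bernoulli' n / n ! : ℚ) : 𝕂)‖ = |(bernoulli' n : ℝ)| / n ! := by
    rw [norm_ratCast_rclike]
    push_cast
    rw [abs_div, Nat.abs_cast]
  calc ‖((bernoulli' n / n ! : ℚ) : 𝕂) • T ^ n‖
      ≤ ‖((bernoulli' n / n ! : ℚ) : 𝕂)‖ * ‖T ^ n‖ := norm_smul_le _ _
    _ ≤ (|(bernoulli' n : ℝ)| / n !) * ‖T‖ ^ n := by
        rw [hcoef]
        exact mul_le_mul_of_nonneg_left (norm_pow_le_pow_norm T n) (by positivity)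
    _ ≤ (π ^ 2 / 3) / (2 * π) ^ n * ‖T‖ ^ n :=
        mul_le_mul_of_nonneg_right (abs_bernoulli'_div_factorial_le n) (by positivity)
    _ = π ^ 2 / 3 * (‖T‖ / (2 * π)) ^ n := by
        rw [div_pow]; field_simp

/-- The `g`-series in the `Σ cₙ Tⁿ` shape: `Σ ‖((−1)ⁿ/(n+1)!) Tⁿ‖ < ∞` for every `T` (rational coefficients).
[cite: Balaban1985Averaging, (33) p.22] -/
theorem summable_norm_gCoeff_term (T : E) :
    Summable fun n : ℕ => ‖(((-1 : ℚ) ^ n / (n + 1)! : ℚ) : 𝕂) • T ^ n‖ := by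
  refine (summable_norm_gSer_term (𝕂 := 𝕂) T).congr fun n => ?_
  rw [show -T = (-1 : 𝕂) • T by simp, smul_pow, smul_smul]
  congr 2
  push_cast
  ring

/-- `g(T) = Σ ((−1)ⁿ/(n+1)!) Tⁿ` with the coefficients written as rationals.
[cite: Balaban1985Averaging, (33) p.22] -/
theorem gSer_eq_tsum_ratCast [CompleteSpace E] (T : E) :
    gSer 𝕂 T = ∑' n : ℕ, (((-1 : ℚ) ^ n / (n + 1)! : ℚ) : 𝕂) • T ^ n := by
  rw [gSer_eq_tsum_neg_one_pow]
  refine tsum_congr fun n => ?_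
  congr 1
  push_cast
  ring

variable [CompleteSpace E]

omit [CompleteSpace E] in
/-- The Cauchy-product terms on an antidiagonal collapse to the formal coefficient identity:
`Σ_{i+j=N} ((B⁺ᵢ/i!)Tⁱ)(((−1)ʲ/(j+1)!)Tʲ) = δ_{N,0}·1`. [cite: Balaban1985Averaging, (34) p.23] -/
private theorem sum_antidiagonal_terms (T : E) (N : ℕ) :
    ∑ p ∈ antidiagonal N, (((bernoulli' p.1 / (p.1)! : ℚ) : 𝕂) • T ^ p.1) *
        ((((-1 : ℚ) ^ p.2 / (p.2 + 1)! : ℚ) : 𝕂) • T ^ p.2) = if N = 0 then 1 else 0 := by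
  have hterm : ∀ p ∈ antidiagonal N, (((bernoulli' p.1 / (p.1)! : ℚ) : 𝕂) • T ^ p.1) *
      ((((-1 : ℚ) ^ p.2 / (p.2 + 1)! : ℚ) : 𝕂) • T ^ p.2) =
      (((bernoulli' p.1 / (p.1)! : ℚ) * ((-1 : ℚ) ^ p.2 / (p.2 + 1)!) : ℚ) : 𝕂) • T ^ N := by
    intro p hp
    rw [mem_antidiagonal] at hp
    rw [smul_mul_smul_comm, ← pow_add, hp, Rat.cast_mul]
  rw [sum_congr rfl hterm, ← sum_smul, ← Rat.cast_sum, sum_antidiagonal_bernoulli'_gCoeff]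
  split_ifs with h
  · subst h; simp
  · simp

omit [CompleteSpace E] in
/-- Swapped order: `Σ_{i+j=N} (((−1)ⁱ/(i+1)!)Tⁱ)((B⁺ⱼ/j!)Tʲ) = δ_{N,0}·1`. [cite: Balaban1985Averaging, (34) p.23] -/
private theorem sum_antidiagonal_terms' (T : E) (N : ℕ) :
    ∑ p ∈ antidiagonal N, ((((-1 : ℚ) ^ p.1 / (p.1 + 1)! : ℚ) : 𝕂) • T ^ p.1) *
        (((bernoulli' p.2 / (p.2)! : ℚ) : 𝕂) • T ^ p.2) = if N = 0 then 1 else 0 := by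
  rw [← sum_antidiagonal_terms (𝕂 := 𝕂) T N, ← Nat.sum_antidiagonal_swap]
  refine sum_congr rfl fun p hp => ?_
  simp only [Prod.fst_swap, Prod.snd_swap]
  rw [smul_mul_smul_comm, smul_mul_smul_comm, ← pow_add, ← pow_add, Nat.add_comm p.2 p.1, mul_comm]

/-- **`(Σ (B⁺ₙ/n!) Tⁿ) · g(T) = 1`** for `‖T‖ < 2π` (Cauchy product of absolutely convergent series + §2).
[cite: Balaban1985Averaging, (34) p.23] -/
theorem tsum_bernoulli_mul_gSer [NormOneClass E] {T : E} (hT : ‖T‖ < 2 * π) :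
    (∑' n : ℕ, ((bernoulli' n / n ! : ℚ) : 𝕂) • T ^ n) * gSer 𝕂 T = 1 := by
  rw [gSer_eq_tsum_ratCast (𝕂 := 𝕂) T,
    tsum_mul_tsum_eq_tsum_sum_antidiagonal_of_summable_norm (summable_norm_bernoulli_term hT)
      (summable_norm_gCoeff_term T)]
  simp_rw [sum_antidiagonal_terms]
  exact tsum_ite_eq 0 1

/-- **`g(T) · (Σ (B⁺ₙ/n!) Tⁿ) = 1`** for `‖T‖ < 2π`. [cite: Balaban1985Averaging, (34) p.23] -/
theorem gSer_mul_tsum_bernoulli [NormOneClass E] {T : E} (hT : ‖T‖ < 2 * π) :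
    gSer 𝕂 T * (∑' n : ℕ, ((bernoulli' n / n ! : ℚ) : 𝕂) • T ^ n) = 1 := by
  rw [gSer_eq_tsum_ratCast (𝕂 := 𝕂) T,
    tsum_mul_tsum_eq_tsum_sum_antidiagonal_of_summable_norm (summable_norm_gCoeff_term T)
      (summable_norm_bernoulli_term hT)]
  simp_rw [sum_antidiagonal_terms']
  exact tsum_ite_eq 0 1

end Banach

/-! ### §4. (34): `g(T)` is invertible on `‖T‖ < 2π` and `g⁻¹(T) = Σ (B⁺ₙ/n!) Tⁿ` -/

section Inverse

variable {𝕂 : Type*} [RCLike 𝕂] {E : Type*} [NormedRing E] [NormedAlgebra 𝕂 E] [CompleteSpace E] [NormOneClass E]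

/-- **(34) on the sharp disc: `g(T)` is invertible for `‖T‖ < 2π`** in any Banach algebra («g⁻¹ … analytic in a
neighborhood of 0»; the tree's `isUnit_gSer` covers `‖T‖ ≤ 1`, `ExpDifferentialBijective.isUnit_gSer_of_norm_lt_two_pi`
the finite-dimensional case). [cite: Balaban1985Averaging, (34) p.23] -/
theorem isUnit_gSer_of_norm_lt {T : E} (hT : ‖T‖ < 2 * π) : IsUnit (gSer 𝕂 T) :=
  ⟨⟨gSer 𝕂 T, ∑' n : ℕ, ((bernoulli' n / n ! : ℚ) : 𝕂) • T ^ n, gSer_mul_tsum_bernoulli hT,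
    tsum_bernoulli_mul_gSer hT⟩, rfl⟩

/-- **(34): `g⁻¹(T) = Σ_{n≥0} (B⁺ₙ/n!) Tⁿ` for `‖T‖ < 2π`** — «g⁻¹(z) = 1 + ½z + …» with every coefficient:
`1, ½, 1/12, 0, −1/720, 0, …` = `bernoulli' n / n!` (`gInv 𝕂 T = Ring.inverse (g T)`).
[cite: Balaban1985Averaging, (34) p.23] -/
theorem gInv_eq_tsum_bernoulli {T : E} (hT : ‖T‖ < 2 * π) :
    gInv 𝕂 T = ∑' n : ℕ, ((bernoulli' n / n ! : ℚ) : 𝕂) • T ^ n := by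
  let u : Eˣ := ⟨gSer 𝕂 T, ∑' n : ℕ, ((bernoulli' n / n ! : ℚ) : 𝕂) • T ^ n, gSer_mul_tsum_bernoulli hT,
    tsum_bernoulli_mul_gSer hT⟩
  rw [gInv, show gSer 𝕂 T = (u : E) from rfl, Ring.inverse_unit]
  rfl

/-- `g⁻¹(T) g(T) = 1` on `‖T‖ < 2π`. [cite: Balaban1985Averaging, (34) p.23] -/
theorem gInv_mul_gSer_of_norm_lt {T : E} (hT : ‖T‖ < 2 * π) : gInv 𝕂 T * gSer 𝕂 T = 1 := by
  rw [gInv_eq_tsum_bernoulli hT]; exact tsum_bernoulli_mul_gSer hT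

/-- `g(T) g⁻¹(T) = 1` on `‖T‖ < 2π`. [cite: Balaban1985Averaging, (34) p.23] -/
theorem gSer_mul_gInv_of_norm_lt {T : E} (hT : ‖T‖ < 2 * π) : gSer 𝕂 T * gInv 𝕂 T = 1 := by
  rw [gInv_eq_tsum_bernoulli hT]; exact gSer_mul_tsum_bernoulli hT

omit [CompleteSpace E] [NormOneClass E] in
/-- The first coefficients of (34): `g⁻¹(z) = 1 + ½z + (1/12)z² + 0·z³ − (1/720)z⁴ + …` (Mathlib's values of
`bernoulli'`). [cite: Balaban1985Averaging, (34) p.23] -/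
theorem bernoulli'_div_factorial_low :
    (bernoulli' 0 / (0 ! : ℚ), bernoulli' 1 / (1 ! : ℚ), bernoulli' 2 / (2 ! : ℚ), bernoulli' 3 / (3 ! : ℚ),
      bernoulli' 4 / (4 ! : ℚ)) = (1, 1 / 2, 1 / 12, 0, -1 / 720) := by
  norm_num [bernoulli'_zero, bernoulli'_one, bernoulli'_two, bernoulli'_three, bernoulli'_four, Nat.factorial]

end Inverse

/-! ### §5. (35): `f(T) = g⁻¹(T) − ½T = 1 + Σ_{p≥1} k_{2p} T^{2p}`, `k_{2p} = B_{2p}/(2p)!`, and `g⁻¹(−T) = g⁻¹(T) − T` -/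

section Even

variable {𝕂 : Type*} [RCLike 𝕂] {E : Type*} [NormedRing E] [NormedAlgebra 𝕂 E]

/-- The odd part of the series (34) is the single term `½T`: `(B⁺_{2p+1}/(2p+1)!)T^{2p+1} = ½T` for `p = 0` and `0` for
`p ≥ 1`. [cite: Balaban1985Averaging, (35) p.23] -/
theorem bernoulli_term_odd (T : E) (p : ℕ) :
    ((bernoulli' (2 * p + 1) / (2 * p + 1)! : ℚ) : 𝕂) • T ^ (2 * p + 1) = if p = 0 then (2⁻¹ : 𝕂) • T else 0 := by
  rcases Nat.eq_zero_or_pos p with rfl | hp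
  · simp [bernoulli'_one]
  · have hodd : Odd (2 * p + 1) := ⟨p, rfl⟩
    rw [bernoulli'_eq_zero_of_odd hodd (by omega)]
    simp [Nat.pos_iff_ne_zero.mp hp]

/-- The even coefficients of (34)–(35) are `k_{2p} = B_{2p}/(2p)!` (`bernoulli' (2p) = bernoulli (2p)`).
[cite: Balaban1985Averaging, (35) p.23] -/
theorem bernoulli_term_even (T : E) (p : ℕ) :
    ((bernoulli' (2 * p) / (2 * p)! : ℚ) : 𝕂) • T ^ (2 * p) =
      ((bernoulli (2 * p) / (2 * p)! : ℚ) : 𝕂) • T ^ (2 * p) := by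
  rw [bernoulli'_eq_bernoulli, (even_two_mul p).neg_one_pow, one_mul]

/-- The `p = 0` term of (35) is `1`: `f(z) = 1 + Σ_{p≥1} …`. [cite: Balaban1985Averaging, (35) p.23] -/
theorem bernoulli_term_even_zero [NormOneClass E] (T : E) :
    ((bernoulli (2 * 0) / (2 * 0)! : ℚ) : 𝕂) • T ^ (2 * 0) = 1 := by
  simp [bernoulli_zero]

variable [CompleteSpace E] [NormOneClass E]

/-- **(35) with the coefficients named**: for `‖T‖ < 2π`,
`g⁻¹(T) − ½T = Σ_{p≥0} (B_{2p}/(2p)!) T^{2p} = 1 + Σ_{p≥1} k_{2p}T^{2p}`, `k_{2p} = B_{2p}/(2p)!` — «Defining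
f(z) = g⁻¹(z) − ½z … f(z) = 1 + Σ_{p=1}^∞ k_{2p}z^{2p}». [cite: Balaban1985Averaging, (35) p.23] -/
theorem gInv_sub_half_smul_eq_tsum_even {T : E} (hT : ‖T‖ < 2 * π) :
    gInv 𝕂 T - (2⁻¹ : 𝕂) • T = ∑' p : ℕ, ((bernoulli (2 * p) / (2 * p)! : ℚ) : 𝕂) • T ^ (2 * p) := by
  have hs := (summable_norm_bernoulli_term (𝕂 := 𝕂) hT).of_norm
  have he : Summable fun p : ℕ => ((bernoulli' (2 * p) / (2 * p)! : ℚ) : 𝕂) • T ^ (2 * p) :=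
    hs.comp_injective (mul_right_injective₀ (two_ne_zero' ℕ))
  have ho : Summable fun p : ℕ => ((bernoulli' (2 * p + 1) / (2 * p + 1)! : ℚ) : 𝕂) • T ^ (2 * p + 1) :=
    hs.comp_injective ((add_left_injective 1).comp (mul_right_injective₀ (two_ne_zero' ℕ)))
  have hsplit := tsum_even_add_odd (f := fun n : ℕ => ((bernoulli' n / n ! : ℚ) : 𝕂) • T ^ n) he ho
  have hodd : ∑' p : ℕ, ((bernoulli' (2 * p + 1) / (2 * p + 1)! : ℚ) : 𝕂) • T ^ (2 * p + 1) = (2⁻¹ : 𝕂) • T := by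
    simp_rw [bernoulli_term_odd]
    exact tsum_ite_eq 0 _
  rw [gInv_eq_tsum_bernoulli hT, ← hsplit, hodd, add_sub_cancel_right]
  exact tsum_congr fun p => bernoulli_term_even T p

/-- **«f(−z) = f(z)»** (35): `g⁻¹(−T) + ½T = g⁻¹(T) − ½T` for `‖T‖ < 2π` (the even series is invariant under
`T ↦ −T`). [cite: Balaban1985Averaging, (35) p.23] -/
theorem gInv_neg_sub_eq {T : E} (hT : ‖T‖ < 2 * π) :
    gInv 𝕂 (-T) - (2⁻¹ : 𝕂) • (-T) = gInv 𝕂 T - (2⁻¹ : 𝕂) • T := by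
  have hT' : ‖-T‖ < 2 * π := by rwa [norm_neg]
  rw [gInv_sub_half_smul_eq_tsum_even hT', gInv_sub_half_smul_eq_tsum_even hT]
  refine tsum_congr fun p => ?_
  rw [(even_two_mul p).neg_pow]

/-- **«g⁻¹(−z) = g⁻¹(z) − z»** (34), now on the whole disc `‖T‖ < 2π` (the tree's `gInv_neg` needs `‖T‖ ≤ 1`).
[cite: Balaban1985Averaging, (34) p.23] -/
theorem gInv_neg_of_norm_lt {T : E} (hT : ‖T‖ < 2 * π) : gInv 𝕂 (-T) = gInv 𝕂 T - T := by
  have h := gInv_neg_sub_eq (𝕂 := 𝕂) hT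
  rw [smul_neg, sub_neg_eq_add] at h
  have h2 : gInv 𝕂 (-T) = gInv 𝕂 T - (2⁻¹ : 𝕂) • T - (2⁻¹ : 𝕂) • T := by rw [← h, add_sub_cancel_right]
  rw [h2, sub_sub, ← add_smul, ← two_mul, mul_inv_cancel₀ (two_ne_zero : (2 : 𝕂) ≠ 0), one_smul]

end Even

end Literature.Analysis.Calculus.ExpDifferential
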